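import Literature.AnabelianGeometry.SemiGraphs.ArithThm54CharCoresCapstoneV8
import HarnessLib

/-!
# [SemiAnbd] Def 5.1 (i)(c) / [IUTchI] Rmk 2.5.3 (vi) (O3): an outer action of a STRONGLY COMPLETE group is
# congruence-continuous modulo every characteristic finite-index subgroup — what strong completeness of `Π_A`
# does (and does not) give towards the T54 design input `hCC`

Mochizuki, *Semi-graphs of anabelioids*, Publ. RIMS **42** (2006), §5 Def 5.1 (i)(a)(c) p. 62 ("`π̂₁(A)` is
topologically finitely generated"; "the resulting outer homomorphism `H → Out(π̂₁(𝔾_v))` … is continuous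
[relative to the natural profinite group topology on `Out(π̂₁(𝔾_v))`]"), Prop 5.2 (i) p. 63
[cite: MochizukiSemiAnbd2006, Def 5.1 (i), p. 62]; the author's later observation [IUTchI] Rmk 2.5.3 (vi) (O3)
("since `H` is topologically finitely generated, every subgroup of finite index is open [NS], so (c) holds
automatically") is typed here in the form the kernel can carry WITHOUT Nikolov–Segal: the hypothesis is STRONG
COMPLETENESS of `Π_A` itself, spelled as in the tree (`∀ H : Subgroup Π_A, H.FiniteIndex → IsOpen ↑H`;
`Literature/GroupTheory/*StronglyComplete*`, `MLFGaloisStronglyComplete*`).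

PROOF-ONLY file (abc-iut cell, layer L3, T54-B board; seat abc-iut-w4-d029 gen 6, L3-lead β3 (6) «T54-CAPSTONE-v9 =
hCC from (hsc : strongly complete)» — VERDICT: the typed `hCC` does NOT follow; this file lands the half that does).
No definition, no new named fact.

* `exists_nhds_forall_rep_congr_of_forall_finiteIndex_isOpen` — GENERIC: `G` any topological group,
  `ρ′ : Π_A →* Out_top(G)` ANY homomorphism (no continuity assumed), `Π_A` strongly complete, `C ≤ G` normal of finite
  index and stable under every bi-continuous automorphism.  Then there is a neighbourhood `U` of `1` in `Π_A` such
  that every `a ∈ U` has a representative `φ ∈ Aut_top(G)` of `ρ′ a` with `φ(y)·y⁻¹ ∈ C` for all `y` — i.e. the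
  outer action is trivial on `G/C` near `1`.  Proof: the set `S` of such `a` is a subgroup; two elements whose chosen
  representatives induce the same self-map of the finite set `G ⧸ C` lie in one coset of `S`, so `[Π_A : S] ≤
  #(G⧸C → G⧸C) < ∞`, and `S` is open by strong completeness.
* `exists_nhds_forall_apply_eq_one_of_finite` — a homomorphism from a strongly complete group to a FINITE group is
  trivial near `1`; `SemiGraph.finite_aut_of_finite` — a finite semi-graph has finitely many automorphisms; hence
  the base action `Π_A → Aut(𝔾)` of the T54 outer model is trivial near `1` (the `baseAct a = 1` conjunct of `hCC`).
* `GaloisLevelData.exists_nhds_forall_rep_congr_ker_piLevelAut` — AT THE CHART OF A COFINAL GALOIS TOWER with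
  CHARACTERISTIC finite levels (`hker : ker π_n = charOpenCore (d n)`, abc-iut-L3-t9 / abc-iut-w4-d048): for every
  `n`, near `1` every `ρ′ a` has a representative congruent to the identity modulo the FINITE level
  `ker (D.piLevelAut n)`; `…_and_baseAct_eq_one` adds the base clause.  This is print's Def 5.1 (i)(c) at the
  vertex-group / finite-level (PROFINITE) topology — (O3) in kernel form.

WHAT THIS DOES NOT GIVE (recorded, not claimed): the capstone's binder `hCC` (v4–v8, abc-iut-w6-d117's label) is
congruence modulo `ker (D.projAut n)`, whose quotient `Gal(𝒢_{∞,n}/𝒢)` is an INFINITE discrete virtually free group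
(`TemperedPiChartVirtuallyFreeTower`); `ker (D.projAut n) ≤ ker (D.piLevelAut n)` (`ker_projAut_le_ker_piLevelAut`)
is the wrong direction, and no finite-index argument on `Π_A` reaches a subgroup of infinite index.  That TEMPERED
congruence-continuity is the input of Prop 5.2 (i) (the content of the (c^new)/(d^new) erratum of [IUTchI]
Rmk 2.5.3 (vi)) and stays a DESIGN datum of the outer model.  Nothing here bears on [IUTchIII] Cor. 3.12;
typed ≠ proved.
-/

namespace Literature.AnabelianGeometry.SemiGraphs

open CategoryTheory Topology Filter Literature.AnabelianGeometry.EtaleTheta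

universe u

/-! ### §1. Generic: outer actions of strongly complete groups are congruence-continuous modulo characteristic
finite-index subgroups -/

section Generic

variable {G : Type*} [Group G] [TopologicalSpace G] {PA : Type*} [Group PA] [TopologicalSpace PA]

/-- **An outer action of a strongly complete group is congruence-continuous modulo every characteristic normal
subgroup of finite index** ([SemiAnbd] Def 5.1 (i)(c) in the form of [IUTchI] Rmk 2.5.3 (vi) (O3)): for `ρ′ :
Π_A → Out_top(G)` any homomorphism, `Π_A` strongly complete (every finite-index subgroup open) and `C ⊴ G` of finite
index stable under all bi-continuous automorphisms, some neighbourhood of `1` in `Π_A` consists of elements whose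
outer class has a representative congruent to the identity modulo `C`.
[cite: MochizukiSemiAnbd2006, Def 5.1 (i), p. 62] -/
theorem exists_nhds_forall_rep_congr_of_forall_finiteIndex_isOpen (ρ' : PA →* TopOut G)
    (hsc : ∀ H : Subgroup PA, H.FiniteIndex → IsOpen (H : Set PA))
    (C : Subgroup G) [C.Normal] [C.FiniteIndex]
    (hC : ∀ φ : contMulAut G, ∀ x ∈ C, (φ : MulAut G) x ∈ C) :
    ∃ U ∈ 𝓝 (1 : PA), ∀ a ∈ U, ∃ φ : contMulAut G, TopOut.mk G φ = ρ' a ∧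
      ∀ y : G, (φ : MulAut G) y * y⁻¹ ∈ C := by
  classical
  -- the subgroup of elements whose class has a representative congruent to `id` mod `C`
  let S : Subgroup PA :=
    { carrier := {a | ∃ φ : contMulAut G, TopOut.mk G φ = ρ' a ∧ ∀ y : G, (φ : MulAut G) y * y⁻¹ ∈ C}
      one_mem' := ⟨1, by rw [map_one, map_one], fun y => by
        rw [show ((1 : contMulAut G) : MulAut G) y = y from rfl, mul_inv_cancel]; exact C.one_mem⟩
      mul_mem' := by
        rintro a b ⟨φ, hφ, hφC⟩ ⟨ψ, hψ, hψC⟩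
        refine ⟨φ * ψ, by rw [map_mul, map_mul, hφ, hψ], fun y => ?_⟩
        have : ((φ * ψ : contMulAut G) : MulAut G) y * y⁻¹ =
            ((φ : MulAut G) ((ψ : MulAut G) y) * ((ψ : MulAut G) y)⁻¹) * ((ψ : MulAut G) y * y⁻¹) := by
          rw [Subgroup.coe_mul, MulAut.mul_apply]; group
        rw [this]
        exact C.mul_mem (hφC _) (hψC y)
      inv_mem' := by
        rintro a ⟨φ, hφ, hφC⟩
        refine ⟨φ⁻¹, by rw [map_inv, map_inv, hφ], fun y => ?_⟩
        -- `φ⁻¹ y · y⁻¹ = (φ w · w⁻¹)⁻¹` with `w := φ⁻¹ y`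
        set w : G := ((φ⁻¹ : contMulAut G) : MulAut G) y with hw
        have hy : (φ : MulAut G) w = y := by
          rw [hw, InvMemClass.coe_inv, ← MulAut.mul_apply, mul_inv_cancel]; rfl
        have : w * y⁻¹ = ((φ : MulAut G) w * w⁻¹)⁻¹ := by rw [hy]; group
        rw [this]
        exact C.inv_mem (hφC w) }
  -- a chosen representative of each class, and the induced self-map of the finite set `G ⧸ C`
  have hrep : ∀ a : PA, ∃ φ : contMulAut G, TopOut.mk G φ = ρ' a := fun a => QuotientGroup.mk_surjective (ρ' a)
  choose rep hrep using hrep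
  have hle : ∀ a : PA, C ≤ C.comap ((rep a : MulAut G).toMonoidHom) := fun a x hx => hC (rep a) x hx
  let f : PA → (G ⧸ C) → (G ⧸ C) := fun a => QuotientGroup.map C C ((rep a : MulAut G).toMonoidHom) (hle a)
  -- two elements with the same induced map lie in one coset of `S`
  have key : ∀ a b : PA, f a = f b → b⁻¹ * a ∈ S := by
    intro a b hab
    refine ⟨(rep b)⁻¹ * rep a, by rw [map_mul, map_inv, hrep, hrep, map_mul, map_inv], fun y => ?_⟩
    have h1 : (QuotientGroup.mk ((rep a : MulAut G) y) : G ⧸ C) = QuotientGroup.mk ((rep b : MulAut G) y) := by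
      have := congr_fun hab (QuotientGroup.mk y)
      simpa only [f, QuotientGroup.map_mk, MulEquiv.coe_toMonoidHom] using this
    -- `rep a y = rep b y · c` with `c ∈ C`
    obtain ⟨c, hc, hcy⟩ : ∃ c ∈ C, (rep a : MulAut G) y = (rep b : MulAut G) y * c := by
      refine ⟨((rep b : MulAut G) y)⁻¹ * (rep a : MulAut G) y, QuotientGroup.eq.mp h1.symm, by group⟩
    -- apply `(rep b)⁻¹`: `((rep b)⁻¹ ∘ rep a) y = y · (rep b)⁻¹ c`
    have h2 : (((rep b)⁻¹ * rep a : contMulAut G) : MulAut G) y =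
        y * (((rep b)⁻¹ : contMulAut G) : MulAut G) c := by
      rw [Subgroup.coe_mul, MulAut.mul_apply, hcy, map_mul, InvMemClass.coe_inv, ← MulAut.mul_apply,
        inv_mul_cancel]
      rfl
    rw [h2]
    -- `y · ((rep b)⁻¹ c) · y⁻¹ ∈ C` by normality and stability of `C`
    exact (inferInstance : C.Normal).conj_mem _ (hC (rep b)⁻¹ c hc) y
  -- hence `Π_A ⧸ S` is finite: it is the image of the finite set `range f`
  haveI : Finite (PA ⧸ S) := by
    haveI : Finite (Set.range f) := inferInstance
    refine Finite.of_surjective (fun x : Set.range f => (QuotientGroup.mk x.2.choose : PA ⧸ S)) ?_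
    rintro ⟨a⟩
    refine ⟨⟨f a, a, rfl⟩, ?_⟩
    change (QuotientGroup.mk _ : PA ⧸ S) = QuotientGroup.mk a
    have hb : f (Exists.choose (⟨a, rfl⟩ : f a ∈ Set.range f)) = f a :=
      Exists.choose_spec (⟨a, rfl⟩ : f a ∈ Set.range f)
    exact QuotientGroup.eq.mpr (key a _ hb.symm)
  haveI : S.FiniteIndex := Subgroup.finiteIndex_of_finite_quotient
  exact ⟨S, (hsc S inferInstance).mem_nhds S.one_mem, fun a ha => ha⟩

/-- A homomorphism from a strongly complete group to a finite group is trivial on a neighbourhood of `1` (its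
kernel has finite index, hence is open). [cite: MochizukiSemiAnbd2006, Def 5.1 (i), p. 62] -/
theorem exists_nhds_forall_apply_eq_one_of_finite {M : Type*} [Group M] [Finite M] (f : PA →* M)
    (hsc : ∀ H : Subgroup PA, H.FiniteIndex → IsOpen (H : Set PA)) :
    ∃ U ∈ 𝓝 (1 : PA), ∀ a ∈ U, f a = 1 := by
  haveI : Finite (PA ⧸ f.ker) := Finite.of_equiv _ (QuotientGroup.quotientKerEquivRange f).symm.toEquiv
  haveI : f.ker.FiniteIndex := Subgroup.finiteIndex_of_finite_quotient
  exact ⟨f.ker, (hsc f.ker inferInstance).mem_nhds f.ker.one_mem, fun a ha => (MonoidHom.mem_ker).mp ha⟩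

end Generic

/-! ### §2. A finite semi-graph has finitely many automorphisms -/

/-- A semi-graph with finitely many vertices, edges and branches has finitely many automorphisms (an automorphism
is determined by its three maps). [cite: MochizukiSemiAnbd2006, §1, p. 11] -/
theorem SemiGraph.finite_aut_of_finite (G : SemiGraph.{u}) [Finite G.Vertex] [Finite G.Edge] [Finite G.Branch] :
    Finite (Aut G) :=
  Finite.of_injective (fun α : Aut G => (α.hom.vertexMap, α.hom.edgeMap, α.hom.branchMap))
    fun α β h => by
      simp only [Prod.mk.injEq] at h
      exact Iso.ext (SemiGraph.hom_ext _ _ h.1 h.2.1 h.2.2)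

namespace ProfiniteSemiGraph

variable {𝒢 : ProfiniteSemiGraph.{u}}

/-- **The base action of the T54 outer model is trivial near `1`** when `Π_A` is strongly complete and the
underlying semi-graph is finite: the `baseAct a = 1` conjunct of the capstone's `hCC` (Def 5.1 (i)(c), first
clause: "the action of `H` on `𝔾` is trivial"). [cite: MochizukiSemiAnbd2006, Def 5.1 (i), p. 62] -/
theorem exists_nhds_forall_baseAct_eq_one [Finite 𝒢.graph.Vertex] [Finite 𝒢.graph.Edge] [Finite 𝒢.graph.Branch]
    {PA : Type*} [Group PA] [TopologicalSpace PA] (baseAct : PA →* Aut 𝒢.graph)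
    (hsc : ∀ H : Subgroup PA, H.FiniteIndex → IsOpen (H : Set PA)) :
    ∃ U ∈ 𝓝 (1 : PA), ∀ a ∈ U, baseAct a = 1 :=
  haveI := SemiGraph.finite_aut_of_finite 𝒢.graph
  exists_nhds_forall_apply_eq_one_of_finite baseAct hsc

/-! ### §3. At the chart of a cofinal Galois tower with characteristic finite levels -/

namespace GaloisLevelData

variable (D : GaloisLevelData 𝒢) (h𝒢 : 𝒢.IsCountable)
  (hconn : ∀ (n : ℕ) (p q : (D.S n).Point), (D.S n).SameComponent p q)
  (hfin : ∀ n, (D.S n).IsFinite)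
  (d : ℕ → ℕ) (hker : ∀ n, (D.piLevelAut h𝒢 hconn n).ker = charOpenCore (D.temperedPi h𝒢) (d n))
  {PA : Type*} [Group PA] [TopologicalSpace PA] (ρ' : PA →* TopOut (D.temperedPi h𝒢))
  (hsc : ∀ H : Subgroup PA, H.FiniteIndex → IsOpen (H : Set PA))

include hfin hker hsc in
/-- **Def 5.1 (i)(c) at the FINITE characteristic levels of `π₁^temp(𝒢)`, from strong completeness of `Π_A`**
([IUTchI] Rmk 2.5.3 (vi) (O3) in kernel form): for a cofinal Galois tower `D` whose level kernels
`ker π_n = ker (D.piLevelAut n)` are the characteristic open cores `charOpenCore (d n)` (abc-iut-L3-t9 / the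
characteristic tower of abc-iut-w4-d048) and ANY outer action `ρ′ : Π_A → Out_top(π₁^temp(𝒢))` of a strongly
complete `Π_A`: for every `n`, every `a` in some neighbourhood of `1` has a representative congruent to the
identity modulo `ker π_n`.  (The capstone's `hCC` asks for the same modulo `ker (D.projAut n)`, whose quotient
`Gal(𝒢_{∞,n}/𝒢)` is infinite — NOT reachable this way.) [cite: MochizukiSemiAnbd2006, Def 5.1 (i), p. 62] -/
theorem exists_nhds_forall_rep_congr_ker_piLevelAut (n : ℕ) :
    ∃ U ∈ 𝓝 (1 : PA), ∀ a ∈ U, ∃ φ : contMulAut (D.temperedPi h𝒢), TopOut.mk _ φ = ρ' a ∧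
      ∀ y, (φ : MulAut (D.temperedPi h𝒢)) y * y⁻¹ ∈ (D.piLevelAut h𝒢 hconn n).ker := by
  haveI : Finite (D.temperedPi h𝒢 ⧸ (D.piLevelAut h𝒢 hconn n).ker) := D.finite_quotient_ker_piLevelAut h𝒢 hconn hfin n
  haveI : (D.piLevelAut h𝒢 hconn n).ker.FiniteIndex := Subgroup.finiteIndex_of_finite_quotient
  refine exists_nhds_forall_rep_congr_of_forall_finiteIndex_isOpen ρ' hsc _ fun φ x hx => ?_
  rw [hker] at hx ⊢
  exact apply_mem_charOpenCore (φ : MulAut (D.temperedPi h𝒢)) φ.2.1 φ.2.2 hx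

include hfin hker hsc in
/-- The same together with the triviality of a base action `Π_A → Aut(𝔾)` near `1` (finite `𝔾`): the shape of
the capstone's `hCC` with `ker (D.projAut n)` replaced by the finite characteristic level `ker (D.piLevelAut n)`
— the part of `hCC` that strong completeness of `Π_A` delivers. [cite: MochizukiSemiAnbd2006, Def 5.1 (i), p. 62] -/
theorem exists_nhds_forall_baseAct_eq_one_and_rep_congr_ker_piLevelAut
    [Finite 𝒢.graph.Vertex] [Finite 𝒢.graph.Edge] [Finite 𝒢.graph.Branch] (baseAct : PA →* Aut 𝒢.graph)
    (n : ℕ) :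
    ∃ U ∈ 𝓝 (1 : PA), ∀ a ∈ U, baseAct a = 1 ∧
      ∃ φ : contMulAut (D.temperedPi h𝒢), TopOut.mk _ φ = ρ' a ∧
        ∀ y, (φ : MulAut (D.temperedPi h𝒢)) y * y⁻¹ ∈ (D.piLevelAut h𝒢 hconn n).ker := by
  obtain ⟨U₁, hU₁, h₁⟩ := exists_nhds_forall_baseAct_eq_one baseAct hsc
  obtain ⟨U₂, hU₂, h₂⟩ := D.exists_nhds_forall_rep_congr_ker_piLevelAut h𝒢 hconn hfin d hker ρ' hsc n
  exact ⟨U₁ ∩ U₂, Filter.inter_mem hU₁ hU₂, fun a ha => ⟨h₁ a ha.1, h₂ a ha.2⟩⟩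

end GaloisLevelData

end ProfiniteSemiGraph

end Literature.AnabelianGeometry.SemiGraphs
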